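/-
Copyright: the b2b-balaban T⁴-continuum CRUX team, row NE7b OWNER lineage `t4-ne7b-p1` (gen 147). Project licence.
-/
import Mathlib

/-!
# THE WEIGHTED TRANSPORT AT ORDER FOUR — FIRST INDEX ((766) §3's computation one order up; file (770)).  The weighted class carries at
# order 4 the full-graph letters of the majorant `K4` in 4 roles (slot shapes of ((662)–(665))); the rescaling `t • J_β` turns `K4` into the
# coarse majorant `K4′ = t⁴·Σ_{fibres}K4` ((433)).  THIS FILE transports the FIRST-INDEX letter (slot `y`: `Σ_{x,z,t}K4 y z t x·Π_{pairs}ϑ ≤ κ`)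
# through `β` by exact power counting times the block factor of the weights (`ϑc(βx,βx′) ≤ M·ϑ(x,x′)`):
#   `Σ_{free coarse} K4′(y₁,…)·Π_{pairs}ϑc ≤ t⁴·n·M^6·κ`
# — push the weights in, dominate them on block images by `M^6`, commute the fibre sums under their coarse partners, collapse the three free
# fibres (`Finset.sum_fiberwise`), count the fixed fibre (row NE7b, node U5c; Mathlib only; [folklore] finite sums; generator
# `records/gen770.py`).  The other roles follow by argument permutation as in (768) (successor); orders 2, 3: (766), (768).

Cell `pub-balaban`, sub-cell `t4`, spine estimate NE7b (`T4WeightBudget.RelWeightBound`; the cell's OWN estimate — NOT PRINTED in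
[Bałaban 1983–89], NOT PROVED).  Crux-route work under `Spine/NE7b/` by the row OWNER (`t4-ne7b-p1` gen 147, file (770)) under FREEZE
(0)'s crux-prover clause; NOTHING of Bałaban's is named as a Lean object, valued or asserted; no `T4Continuum/Support` leaf typed; no
`def`, no notation; zero `sorry`.  Imports: Mathlib only; (433)∕(766) met BY SHAPE.

WHAT IS PROVED ([folklore]): **`weighted_coarse_k4_letter_le`**; toy.

HONEST (what this is NOT).  Finite-sum bookkeeping (the other roles, the flow of the letter values not typed); scalar skeleton ((A3), NC-NE7b-α
UNRULED); nothing of Bałaban's asserted.  BY-NAME EFFECT ON THE WALL: NONE.  NE7b NOT PRINTED ∕ NOT PROVED; spine PROVED 0∕9; rung (B)+1 —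
the programme's measures remain FINITE-torus statements; NOT the mass gap, NOT Clay.  HONEST DEPENDENCY: continuum YM on T⁴ ⇐ BetaPertH ∧
nine spine estimates (0∕9 proved); BetaPertH ⇐ (D1) ∧ (D4) ∧ CAP+tail; G-an2-4 gates asym, D1 and NE2∕3∕4.
-/

set_option autoImplicit false

noncomputable section

namespace Summit.QuantumFields.BalabanUV.T4Continuum.NE7b.SupWeightedKernelLetterTransportFour

open Finset
open scoped BigOperators

variable {ι ι' : Type} [Fintype ι] [Fintype ι'] [DecidableEq ι']

set_option maxHeartbeats 1600000 in
/-- **ORDER 4, FIRST INDEX FIXED — WEIGHTED TRANSPORT BY EXACT POWER COUNTING** (the slot shape of `k4ϑ1`): fibres of `≤ n` sites,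
the fine full-graph letter (first `K4`-index fixed) `≤ κ`, and `ϑc(βx,βx′) ≤ M·ϑ(x,x′)` give, for the coarse majorant
`K4′ = t⁴·Σ_{fibres}K4`, the coarse letter `≤ t⁴·n·M^6·κ`. [folklore] -/
theorem weighted_coarse_k4_letter_le (β : ι → ι') {n : ℕ} (hfib : ∀ y, (univ.filter fun x => β x = y).card ≤ n)
    (K4 : ι → ι → ι → ι → ℝ) (hK : ∀ y z tt x, 0 ≤ K4 y z tt x) {ϑ : ι → ι → ℝ} {ϑc : ι' → ι' → ℝ} {M κ : ℝ} (hM : 0 ≤ M)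
    (hϑ0 : ∀ x x', 0 ≤ ϑ x x') (hϑc0 : ∀ y y', 0 ≤ ϑc y y') (hϑ : ∀ x x', ϑc (β x) (β x') ≤ M * ϑ x x') (hκ : 0 ≤ κ)
    (hk : ∀ y, ∑ x, ∑ z, ∑ tt, K4 y z tt x * (ϑ x y * ϑ x z * ϑ x tt * ϑ y z * ϑ y tt * ϑ z tt) ≤ κ) (t : ℝ) (y₁ : ι') :
    ∑ X, ∑ Z, ∑ T,
        (t ^ 4 * ∑ y ∈ Finset.univ.filter (fun y => β y = y₁), ∑ z ∈ Finset.univ.filter (fun z => β z = Z), ∑ tt ∈ Finset.univ.filter (fun tt => β tt = T), ∑ x ∈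
          Finset.univ.filter (fun x => β x = X), K4 y z tt x) * (ϑc X y₁ * ϑc X Z * ϑc X T * ϑc y₁ Z * ϑc y₁ T * ϑc Z T) ≤ t ^ 4 * n * M ^ 6 * κ := by
  have ht : (0:ℝ) ≤ t ^ 4 := by positivity
  have hW : ∀ y z tt x : ι, ϑc (β x) (β y) * ϑc (β x) (β z) * ϑc (β x) (β tt) * ϑc (β y) (β z) * ϑc (β y) (β tt) * ϑc (β z) (β tt) ≤ M ^ 6 *
      (ϑ x y * ϑ x z * ϑ x tt * ϑ y z * ϑ y tt * ϑ z tt) := by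
    intro y z tt x
    have h1 : ϑc (β x) (β y) ≤ M ^ 1 * (ϑ x y) := (hϑ x y).trans_eq (by ring)
    have h2 : ϑc (β x) (β y) * ϑc (β x) (β z) ≤ M ^ 2 * (ϑ x y * ϑ x z) :=
      (mul_le_mul h1 (hϑ x z) (hϑc0 (β x) (β z)) (mul_nonneg (pow_nonneg hM 1) (hϑ0 x y))).trans_eq (by ring)
    have h3 : ϑc (β x) (β y) * ϑc (β x) (β z) * ϑc (β x) (β tt) ≤ M ^ 3 * (ϑ x y * ϑ x z * ϑ x tt) :=
      (mul_le_mul h2 (hϑ x tt) (hϑc0 (β x) (β tt)) (mul_nonneg (pow_nonneg hM 2) (mul_nonneg (hϑ0 x y) (hϑ0 x z)))).trans_eq (by ring)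
    have h4 : ϑc (β x) (β y) * ϑc (β x) (β z) * ϑc (β x) (β tt) * ϑc (β y) (β z) ≤ M ^ 4 * (ϑ x y * ϑ x z * ϑ x tt * ϑ y z) :=
      (mul_le_mul h3 (hϑ y z) (hϑc0 (β y) (β z)) (mul_nonneg (pow_nonneg hM 3) (mul_nonneg (mul_nonneg (hϑ0 x y) (hϑ0 x z)) (hϑ0 x tt)))).trans_eq (by ring)
    have h5 : ϑc (β x) (β y) * ϑc (β x) (β z) * ϑc (β x) (β tt) * ϑc (β y) (β z) * ϑc (β y) (β tt) ≤ M ^ 5 * (ϑ x y * ϑ x z * ϑ x tt * ϑ y z * ϑ y tt) :=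
      (mul_le_mul h4 (hϑ y tt) (hϑc0 (β y) (β tt)) (mul_nonneg (pow_nonneg hM 4) (mul_nonneg (mul_nonneg (mul_nonneg (hϑ0 x y) (hϑ0 x z)) (hϑ0 x tt)) (hϑ0 y z)))).trans_eq
          (by ring)
    have h6 : ϑc (β x) (β y) * ϑc (β x) (β z) * ϑc (β x) (β tt) * ϑc (β y) (β z) * ϑc (β y) (β tt) * ϑc (β z) (β tt) ≤ M ^ 6 *
        (ϑ x y * ϑ x z * ϑ x tt * ϑ y z * ϑ y tt * ϑ z tt) :=
      (mul_le_mul h5 (hϑ z tt) (hϑc0 (β z) (β tt))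
            (mul_nonneg (pow_nonneg hM 5) (mul_nonneg (mul_nonneg (mul_nonneg (mul_nonneg (hϑ0 x y) (hϑ0 x z)) (hϑ0 x tt)) (hϑ0 y z)) (hϑ0 y tt)))).trans_eq (by ring)
    exact h6
  calc
    ∑ X, ∑ Z, ∑ T,
        (t ^ 4 * ∑ y ∈ Finset.univ.filter (fun y => β y = y₁), ∑ z ∈ Finset.univ.filter (fun z => β z = Z), ∑ tt ∈ Finset.univ.filter (fun tt => β tt = T), ∑ x ∈
          Finset.univ.filter (fun x => β x = X), K4 y z tt x) * (ϑc X y₁ * ϑc X Z * ϑc X T * ϑc y₁ Z * ϑc y₁ T * ϑc Z T)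
      = t ^ 4 * ∑ X, ∑ Z, ∑ T, ∑ y ∈ Finset.univ.filter (fun y => β y = y₁), ∑ z ∈ Finset.univ.filter (fun z => β z = Z), ∑ tt ∈ Finset.univ.filter (fun tt => β tt = T),
          ∑ x ∈ Finset.univ.filter (fun x => β x = X), K4 y z tt x * (ϑc X y₁ * ϑc X Z * ϑc X T * ϑc y₁ Z * ϑc y₁ T * ϑc Z T) := by
        rw [mul_sum]
        refine sum_congr rfl fun _ _ => ?_
        rw [mul_sum]
        refine sum_congr rfl fun _ _ => ?_
        rw [mul_sum]
        refine sum_congr rfl fun _ _ => ?_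
        rw [mul_assoc, sum_mul]
        refine congrArg _ (sum_congr rfl fun _ _ => ?_)
        rw [sum_mul]
        refine sum_congr rfl fun _ _ => ?_
        rw [sum_mul]
        refine sum_congr rfl fun _ _ => ?_
        exact sum_mul _ _ _
    _ = t ^ 4 * ∑ X, ∑ Z, ∑ y ∈ Finset.univ.filter (fun y => β y = y₁), ∑ T, ∑ z ∈ Finset.univ.filter (fun z => β z = Z), ∑ tt ∈ Finset.univ.filter (fun tt => β tt = T),
        ∑ x ∈ Finset.univ.filter (fun x => β x = X), K4 y z tt x * (ϑc X y₁ * ϑc X Z * ϑc X T * ϑc y₁ Z * ϑc y₁ T * ϑc Z T) := by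
        congr 1
        exact sum_congr rfl fun _ _ => sum_congr rfl fun _ _ => sum_comm
    _ = t ^ 4 * ∑ X, ∑ y ∈ Finset.univ.filter (fun y => β y = y₁), ∑ Z, ∑ T, ∑ z ∈ Finset.univ.filter (fun z => β z = Z), ∑ tt ∈ Finset.univ.filter (fun tt => β tt = T),
        ∑ x ∈ Finset.univ.filter (fun x => β x = X), K4 y z tt x * (ϑc X y₁ * ϑc X Z * ϑc X T * ϑc y₁ Z * ϑc y₁ T * ϑc Z T) := by
        congr 1
        exact sum_congr rfl fun _ _ => sum_comm
    _ = t ^ 4 * ∑ y ∈ Finset.univ.filter (fun y => β y = y₁), ∑ X, ∑ Z, ∑ T, ∑ z ∈ Finset.univ.filter (fun z => β z = Z), ∑ tt ∈ Finset.univ.filter (fun tt => β tt = T),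
        ∑ x ∈ Finset.univ.filter (fun x => β x = X), K4 y z tt x * (ϑc X y₁ * ϑc X Z * ϑc X T * ϑc y₁ Z * ϑc y₁ T * ϑc Z T) := by
        congr 1
        exact sum_comm
    _ = t ^ 4 * ∑ y ∈ Finset.univ.filter (fun y => β y = y₁), ∑ X, ∑ Z, ∑ T, ∑ z ∈ Finset.univ.filter (fun z => β z = Z), ∑ x ∈ Finset.univ.filter (fun x => β x = X), ∑
        tt ∈ Finset.univ.filter (fun tt => β tt = T), K4 y z tt x * (ϑc X y₁ * ϑc X Z * ϑc X T * ϑc y₁ Z * ϑc y₁ T * ϑc Z T) := by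
        congr 1
        exact sum_congr rfl fun _ _ => sum_congr rfl fun _ _ => sum_congr rfl fun _ _ => sum_congr rfl fun _ _ => sum_congr rfl fun _ _ => sum_comm
    _ = t ^ 4 * ∑ y ∈ Finset.univ.filter (fun y => β y = y₁), ∑ X, ∑ Z, ∑ T, ∑ x ∈ Finset.univ.filter (fun x => β x = X), ∑ z ∈ Finset.univ.filter (fun z => β z = Z), ∑
        tt ∈ Finset.univ.filter (fun tt => β tt = T), K4 y z tt x * (ϑc X y₁ * ϑc X Z * ϑc X T * ϑc y₁ Z * ϑc y₁ T * ϑc Z T) := by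
        congr 1
        exact sum_congr rfl fun _ _ => sum_congr rfl fun _ _ => sum_congr rfl fun _ _ => sum_congr rfl fun _ _ => sum_comm
    _ = t ^ 4 * ∑ y ∈ Finset.univ.filter (fun y => β y = y₁), ∑ X, ∑ Z, ∑ x ∈ Finset.univ.filter (fun x => β x = X), ∑ T, ∑ z ∈ Finset.univ.filter (fun z => β z = Z), ∑
        tt ∈ Finset.univ.filter (fun tt => β tt = T), K4 y z tt x * (ϑc X y₁ * ϑc X Z * ϑc X T * ϑc y₁ Z * ϑc y₁ T * ϑc Z T) := by
        congr 1
        exact sum_congr rfl fun _ _ => sum_congr rfl fun _ _ => sum_congr rfl fun _ _ => sum_comm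
    _ = t ^ 4 * ∑ y ∈ Finset.univ.filter (fun y => β y = y₁), ∑ X, ∑ x ∈ Finset.univ.filter (fun x => β x = X), ∑ Z, ∑ T, ∑ z ∈ Finset.univ.filter (fun z => β z = Z), ∑
        tt ∈ Finset.univ.filter (fun tt => β tt = T), K4 y z tt x * (ϑc X y₁ * ϑc X Z * ϑc X T * ϑc y₁ Z * ϑc y₁ T * ϑc Z T) := by
        congr 1
        exact sum_congr rfl fun _ _ => sum_congr rfl fun _ _ => sum_comm
    _ = t ^ 4 * ∑ y ∈ Finset.univ.filter (fun y => β y = y₁), ∑ X, ∑ x ∈ Finset.univ.filter (fun x => β x = X), ∑ Z, ∑ z ∈ Finset.univ.filter (fun z => β z = Z), ∑ T, ∑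
        tt ∈ Finset.univ.filter (fun tt => β tt = T), K4 y z tt x * (ϑc X y₁ * ϑc X Z * ϑc X T * ϑc y₁ Z * ϑc y₁ T * ϑc Z T) := by
        congr 1
        exact sum_congr rfl fun _ _ => sum_congr rfl fun _ _ => sum_congr rfl fun _ _ => sum_congr rfl fun _ _ => sum_comm
    _ ≤ t ^ 4 * ∑ y ∈ Finset.univ.filter (fun y => β y = y₁), ∑ X, ∑ x ∈ Finset.univ.filter (fun x => β x = X), ∑ Z, ∑ z ∈ Finset.univ.filter (fun z => β z = Z), ∑ T, ∑
        tt ∈ Finset.univ.filter (fun tt => β tt = T), M ^ 6 * (K4 y z tt x * (ϑ x y * ϑ x z * ϑ x tt * ϑ y z * ϑ y tt * ϑ z tt)) := by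
        refine mul_le_mul_of_nonneg_left
            (sum_le_sum fun y hy => sum_le_sum fun X _ => sum_le_sum fun x hx => sum_le_sum fun Z _ => sum_le_sum fun z hz => sum_le_sum fun T _ => sum_le_sum fun tt htt
              => ?_) ht
        rw [← (mem_filter.1 hy).2, ← (mem_filter.1 hz).2, ← (mem_filter.1 htt).2, ← (mem_filter.1 hx).2]
        refine (mul_le_mul_of_nonneg_left (hW y z tt x) (hK y z tt x)).trans_eq ?_
        ring
    _ = t ^ 4 * ∑ y ∈ Finset.univ.filter (fun y => β y = y₁), ∑ X, ∑ x ∈ Finset.univ.filter (fun x => β x = X), ∑ Z, ∑ z ∈ Finset.univ.filter (fun z => β z = Z), ∑ tt, M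
        ^ 6 * (K4 y z tt x * (ϑ x y * ϑ x z * ϑ x tt * ϑ y z * ϑ y tt * ϑ z tt)) := by
        congr 1
        exact sum_congr rfl fun y _ => sum_congr rfl fun X _ => sum_congr rfl fun x _ => sum_congr rfl fun Z _ => sum_congr rfl fun z _ => sum_fiberwise univ β fun tt =>
            M ^ 6 * (K4 y z tt x * (ϑ x y * ϑ x z * ϑ x tt * ϑ y z * ϑ y tt * ϑ z tt))
    _ = t ^ 4 * ∑ y ∈ Finset.univ.filter (fun y => β y = y₁), ∑ X, ∑ x ∈ Finset.univ.filter (fun x => β x = X), ∑ z, ∑ tt, M ^ 6 *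
        (K4 y z tt x * (ϑ x y * ϑ x z * ϑ x tt * ϑ y z * ϑ y tt * ϑ z tt)) := by
        congr 1
        exact sum_congr rfl fun y _ => sum_congr rfl fun X _ => sum_congr rfl fun x _ => sum_fiberwise univ β fun z => ∑ tt, M ^ 6 *
            (K4 y z tt x * (ϑ x y * ϑ x z * ϑ x tt * ϑ y z * ϑ y tt * ϑ z tt))
    _ = t ^ 4 * ∑ y ∈ Finset.univ.filter (fun y => β y = y₁), ∑ x, ∑ z, ∑ tt, M ^ 6 * (K4 y z tt x * (ϑ x y * ϑ x z * ϑ x tt * ϑ y z * ϑ y tt * ϑ z tt)) := by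
        congr 1
        exact sum_congr rfl fun y _ => sum_fiberwise univ β fun x => ∑ z, ∑ tt, M ^ 6 * (K4 y z tt x * (ϑ x y * ϑ x z * ϑ x tt * ϑ y z * ϑ y tt * ϑ z tt))
    _ = t ^ 4 * ∑ y ∈ Finset.univ.filter (fun y => β y = y₁), M ^ 6 * ∑ x, ∑ z, ∑ tt, K4 y z tt x * (ϑ x y * ϑ x z * ϑ x tt * ϑ y z * ϑ y tt * ϑ z tt) := by
        congr 1
        exact sum_congr rfl fun _ _ => by simp only [mul_sum]
    _ ≤ t ^ 4 * ∑ y ∈ Finset.univ.filter (fun y => β y = y₁), M ^ 6 * κ := by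
        gcongr with y _
        exact hk y
    _ = t ^ 4 * (((univ.filter fun x => β x = y₁).card : ℝ) * (M ^ 6 * κ)) := by rw [sum_const, nsmul_eq_mul]
    _ ≤ t ^ 4 * (n * (M ^ 6 * κ)) := mul_le_mul_of_nonneg_left (mul_le_mul_of_nonneg_right (by exact_mod_cast hfib y₁) (mul_nonneg (pow_nonneg hM _) hκ)) ht
    _ = t ^ 4 * n * M ^ 6 * κ := by ring

/-! ## Toy -/

/-- Toy (the power counting in numbers): at order 4 a letter `5` becomes at most `t⁴·n·M^6·5` one scale up; with `t = 1`, `n = 16`,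
`M = 1` that is `80`. -/
example : (1 : ℝ) * 16 * 1 ^ 6 * 5 = 80 := by norm_num

end Summit.QuantumFields.BalabanUV.T4Continuum.NE7b.SupWeightedKernelLetterTransportFour

end
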